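import Summits.QuantumFields.BalabanUV.T4Continuum.Support.ShellMeasureLandauCorrectionB7

/-!
# W-a (Cf) junction — NON-VACUITY AND THE FLAT FACE: the background binders of `landauCorrection_binders` are satisfiable,
# and at the flat background `U₀ = 1` END-II's Landau-correction pair holds with NO background hypothesis, for every `k`
# (`ShellMeasureLandauCorrectionB7Flat`)

Audit cell `pub-balaban`, sub-cell `t4`, NE7c ROUND-2 crew seat `b2b-balaban-t4-ne7c-formalise-leaf-10` gen 9; companion (file 3)
of owner-table row **S64** (main = `ShellMeasureLandauCorrectionB7` p221284: END-II's `hCq` ∕ `hCd` for B7's `C_k(U₀, ·)` in the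
`A`-currency, `C₂ = C2cov d`, `RC = landauRad d L`).  INPUTS BY NAME: S64 main (`landauCf`, `landauLin`, `scaleIns`, `landauRad`,
`landauCorrection_binders`, `landauCorrection_quadAnalytic`), S56 f2∕f3 (`C1cov`, `O1cov`, `C2cov`, `logCovIter_one_left`,
`linCovIter`), b07 (`B7Prop2Explicit.AvgClosed`, `pdev`, `C0`, `c2'`; `B8Ineq130.hol_one` ∕ `bavg_one`; `B7Prop4Flat.logIter` ∕
`linQIter` ∕ `norm_linQIter_le`; `B7Prop3GeneralLinear.linQcov_one_left`), `B13Contraction113.QuadAnalytic`.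

WHAT THIS FILE PROVES (kernel, 0 sorry; [folklore] bookkeeping — nothing printed is asserted):
* §1 `avgClosed_bot` — the trivial subgroup `{1}` is averaging-closed (`bavg_one`); `pdev_one` — the unit configuration has
  plaquette deviation `0` (`hol_one`); `linCovIter_one_left` — at `U₀ = 1` the composed linear part is b07's `linQIter`
  (companion of f2's `logCovIter_one_left`).
* §2 **`regime_exists`** — NON-VACUITY of the background binders: for `L ≥ 1` there is `α₀ > 0` with `C₀(d)α₀ ≤ 1/3`,
  `4α₀ ≤ c₂′(d,L)` and `4·O1cov(d)·α₀ ≤ 1/3` (print's «for α₀, α₁ ≦ c₄», p. 38: the `α₀`-half of `c₄(d, L)` exists).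
* §3 **`landauCorrection_binders_flat`** ∕ **`landauCorrection_quadAnalytic_flat`** — AT THE FLAT BACKGROUND `U₀ = 1` the pair
  `(∀ A, ‖A‖ < landauRad d L → ‖landauCf L 1 k S S' A‖ ≤ C2cov d * ‖A‖ ^ 2) ∧ DifferentiableOn ℂ (landauCf L 1 k S S') (ball 0 …)`
  holds for EVERY `k`, `S`, `S′` under `2 ≤ L` ALONE (S64 main at `G := ⊥`, `U₀ := 1`, `α₀ :=` §2's witness, (52) by `pdev_one`);
  `landauCf_one_eq` — there `landauCf L 1 k S S' A c = logIter k − linQIter k` of the scaled insertion (b07's flat objects: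
  [Balaban1985Variational] (44) at the flat background in END-II's shape, cf. b07's `B7Prop4Flat.prop4_flat_ins` with `C₂(d) =
  8C₁(d)` and radius `c₄(d)/Lᵏ` in the `B`-currency — here k-UNIFORM in the `A`-currency).
* §4 `norm_landauCf_smul_le` — (44)'s DISPLAY «|C_j(LʲηA)| ≦ C₂(Lʲη)²|A|²»: under S64's binders, for a scalar `t` with
  `‖t•A‖ < landauRad`, `‖landauCf (t•A)‖ ≤ C2cov d·‖t‖²·‖A‖²` (the square of the scaling factor; the identification of `t` with
  `Lʲη` and of `A` with B11's sectioned field on `Ω_j` is W-c [dict] + geometry — SAID, not claimed).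
HONEST (cell): non-vacuity + the flat face of a junction; no live-level estimate of Bałaban's is discharged; «NE7c ⇐ the named
binders»; NE7c NOT PRINTED, NOT PROVED; spine PROVED 0/9; rung (B)+1 on a FINITE T⁴ — NOT infinite volume, NOT mass gap, NOT
Clay.  HONEST DEPENDENCY: continuum YM on T⁴ ⇐ BetaPertH ∧ nine spine estimates (0/9 proved); BetaPertH ⇐ (D1) ∧ (D4) ∧ CAP+tail;
G-an2-4 gates asym, D1 and NE2/3/4.
-/

noncomputable section

open scoped BigOperators
open NormedSpace Metric

namespace Summit.QuantumFields.BalabanUV.T4Continuum.ShellMeasureLandauCorrectionB7Flat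

open Literature.MathematicalPhysics.QuantumFieldTheory.Balaban1983to89
open B7Prop1Explicit B7Prop2Explicit B7Prop3Flat B7Prop4Flat B7Eq92Concrete MatrixLog B7Prop3GeneralLinear
  B7Prop4GeneralLevels
open B8Ineq130 (hol_one bavg_one)
open B13Contraction113 (QuadAnalytic)
open Summit.QuantumFields.BalabanUV.T4Continuum.ShellMeasureAverageProp4General
open Summit.QuantumFields.BalabanUV.T4Continuum.ShellMeasureLandauCorrectionB7

variable {d : ℕ} {𝔸 : Type*} [NormedRing 𝔸] [NormedAlgebra ℂ 𝔸] [CompleteSpace 𝔸] [NormOneClass 𝔸]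

/-! ## §1 The flat background: `{1}` is averaging-closed, `pdev 1 = 0`, the composed linear part is b07's `linQIter` -/

/-- the trivial gauge group `{1}` is averaging-closed (the average of the unit configuration is the unit, `B8Ineq130.bavg_one`).
[folklore] -/
theorem avgClosed_bot (L : ℕ) : AvgClosed d L (⊥ : Subgroup 𝔸ˣ) where
  le_U1 := bot_le
  bavg_mem V hV q κ _ := by
    have hV1 : V = 1 := by
      funext x κ'
      exact Subgroup.mem_bot.1 (hV x κ')
    rw [hV1, bavg_one]
    exact Subgroup.one_mem _

omit [NormedAlgebra ℂ 𝔸] [CompleteSpace 𝔸] [NormOneClass 𝔸] in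
/-- the unit configuration has plaquette deviation `0` (every plaquette holonomy of `1` is `1`, `B8Ineq130.hol_one`). [folklore] -/
theorem pdev_one : pdev (1 : B7Prop1Explicit.Site d → Fin d → 𝔸ˣ) = 0 := by
  unfold pdev
  simp only [hol_one, Units.val_one, sub_self, norm_zero]
  exact Real.iSup_const_zero

/-- at `U₀ = 1` the composed linear part «LʲηQ_j(U₀)» is b07's `linQIter` (companion of f2's `logCovIter_one_left`; the one-step
reduction `B7Prop3GeneralLinear.linQcov_one_left` needs a sup bound on the argument, supplied by `B7Prop4Flat.norm_linQIter_le`).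
[folklore] -/
theorem linCovIter_one_left {L : ℕ} (hL : 1 ≤ L) (B : B7Prop1Explicit.Site d → Fin d → 𝔸) {b : ℝ} (hb : 0 ≤ b)
    (hB : ∀ x κ, ‖B x κ‖ ≤ b) :
    ∀ j : ℕ, linCovIter L (1 : B7Prop1Explicit.Site d → Fin d → 𝔸ˣ) B j = linQIter L B j
  | 0 => rfl
  | j + 1 => by
    funext z κ
    have hL0 : (0 : ℝ) ≤ (L : ℝ) ^ j * b := by positivity
    rw [linCovIter_succ, linQIter_succ, avgIter_one, linCovIter_one_left hL B hb hB j,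
      linQcov_one_left L hL (linQIter L B j) hL0 (norm_linQIter_le L hL B hb hB j) ((L : ℤ) • z) κ]

/-! ## §2 Non-vacuity of the background binders -/

/-- **THE `α₀`-HALF OF PRINT'S `c₄(d, L)` EXISTS**: for `L ≥ 1` there is `α₀ > 0` with `C₀(d)α₀ ≤ 1/3` (Prop. 2), `4α₀ ≤ c₂′(d,L)`
(«α₀ ≦ c₃» in plaquette currency) and `4·O1cov(d)·α₀ ≤ 1/3` (the bracket «O(1)α₀ ≦ 1/6») — so the hypothesis set of
`ShellMeasureLandauCorrectionB7.landauCorrection_binders` on `α₀` is consistent. [folklore] -/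
theorem regime_exists (d : ℕ) {L : ℕ} (hL : 1 ≤ L) :
    ∃ α₀ : ℝ, 0 < α₀ ∧ C0 d * α₀ ≤ 1 / 3 ∧ 4 * α₀ ≤ c2' d L ∧ 4 * O1cov d * α₀ ≤ 1 / 3 := by
  have hC0 := C0_pos d
  have hO := O1cov_pos d
  have hL0 : (0 : ℝ) < L := by exact_mod_cast hL
  have hc2 : 0 < c2' d L := by unfold c2'; positivity
  refine ⟨min (min (1 / (3 * C0 d)) (c2' d L / 4)) (1 / (12 * O1cov d)), ?_, ?_, ?_, ?_⟩
  · positivity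
  · have h : min (min (1 / (3 * C0 d)) (c2' d L / 4)) (1 / (12 * O1cov d)) ≤ 1 / (3 * C0 d) :=
      (min_le_left _ _).trans (min_le_left _ _)
    calc C0 d * min (min (1 / (3 * C0 d)) (c2' d L / 4)) (1 / (12 * O1cov d)) ≤ C0 d * (1 / (3 * C0 d)) :=
          mul_le_mul_of_nonneg_left h hC0.le
      _ = 1 / 3 := by field_simp
  · have h : min (min (1 / (3 * C0 d)) (c2' d L / 4)) (1 / (12 * O1cov d)) ≤ c2' d L / 4 :=
      (min_le_left _ _).trans (min_le_right _ _)
    linarith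
  · have h : min (min (1 / (3 * C0 d)) (c2' d L / 4)) (1 / (12 * O1cov d)) ≤ 1 / (12 * O1cov d) := min_le_right _ _
    calc 4 * O1cov d * min (min (1 / (3 * C0 d)) (c2' d L / 4)) (1 / (12 * O1cov d))
        ≤ 4 * O1cov d * (1 / (12 * O1cov d)) := mul_le_mul_of_nonneg_left h (by positivity)
      _ = 1 / 3 := by field_simp; ring

/-! ## §3 The flat face: END-II's pair at `U₀ = 1` with no background hypothesis, every `k` -/

/-- **[B11] (44) AT THE FLAT BACKGROUND IN END-II's SHAPE, UNCONDITIONAL, k-UNIFORM**: for `L ≥ 2` and EVERY `k`, `S`, `S′`, the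
Landau-correction map `landauCf L 1 k S S' : 𝔸^S → 𝔸^{S′}` of S64 at `U₀ = 1` satisfies END-II's pair — `‖landauCf L 1 k S S' A‖ ≤
C2cov(d)·‖A‖²` for `‖A‖ < landauRad(d,L)` and `DifferentiableOn ℂ (landauCf L 1 k S S') (ball 0 (landauRad d L))` — with NO further
hypothesis (S64 main at the trivial group `⊥`, `U₀ = 1`, (52) by `pdev_one`, `α₀` from `regime_exists`). [folklore] -/
theorem landauCorrection_binders_flat (L : ℕ) (hL : 2 ≤ L) (k : ℕ) (S S' : Finset (B7Prop1Explicit.Site d × Fin d)) :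
    (∀ A : S → 𝔸, ‖A‖ < landauRad d L →
        ‖landauCf L (1 : B7Prop1Explicit.Site d → Fin d → 𝔸ˣ) k S S' A‖ ≤ C2cov d * ‖A‖ ^ 2) ∧
      DifferentiableOn ℂ (landauCf L (1 : B7Prop1Explicit.Site d → Fin d → 𝔸ˣ) k S S') (ball 0 (landauRad d L)) := by
  have hL1 : 1 ≤ L := le_trans (by norm_num) hL
  obtain ⟨α₀, hα, hα3, hα4, hα6⟩ := regime_exists d hL1
  have hL0 : (0 : ℝ) < L := by exact_mod_cast hL1
  have h52 : pdev (1 : B7Prop1Explicit.Site d → Fin d → 𝔸ˣ) < α₀ * (((L : ℝ) ^ k)⁻¹) ^ 2 := by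
    rw [pdev_one]; positivity
  exact landauCorrection_binders L hL (avgClosed_bot L) k 1 (fun _ _ => Subgroup.mem_bot.2 rfl) hα hα3 hα4 hα6 h52 S S'

/-- … and in B13's line-analytic form `QuadAnalytic (landauCf L 1 k S S') (C2cov d) (landauRad d L)`. [folklore] -/
theorem landauCorrection_quadAnalytic_flat (L : ℕ) (hL : 2 ≤ L) (k : ℕ) (S S' : Finset (B7Prop1Explicit.Site d × Fin d)) :
    QuadAnalytic (landauCf L (1 : B7Prop1Explicit.Site d → Fin d → 𝔸ˣ) k S S') (C2cov d) (landauRad d L) := by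
  have hL1 : 1 ≤ L := le_trans (by norm_num) hL
  obtain ⟨α₀, hα, hα3, hα4, hα6⟩ := regime_exists d hL1
  have hL0 : (0 : ℝ) < L := by exact_mod_cast hL1
  have h52 : pdev (1 : B7Prop1Explicit.Site d → Fin d → 𝔸ˣ) < α₀ * (((L : ℝ) ^ k)⁻¹) ^ 2 := by
    rw [pdev_one]; positivity
  exact landauCorrection_quadAnalytic L hL (avgClosed_bot L) k 1 (fun _ _ => Subgroup.mem_bot.2 rfl) hα hα3 hα4 hα6 h52
    S S'

/-- **AT `U₀ = 1` THE OBJECT IS b07's**: `landauCf L 1 k S S' A c = Q_k(1, ηA)(c) − LᵏηQ_k(1)(ηA)(c)` with b07's flat composites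
`B7Prop4Flat.logIter` ∕ `linQIter` of the scaled insertion (f2's `logCovIter_one_left`, §1's `linCovIter_one_left`) — the same
quantity b07's `B7Prop4Flat.prop4_flat_ins` bounds by `C₂(d)(Lᵏ‖B‖)²` in the `B`-currency. [folklore] -/
theorem landauCf_one_eq {L : ℕ} (hL : 1 ≤ L) (k : ℕ) (S S' : Finset (B7Prop1Explicit.Site d × Fin d)) (A : S → 𝔸)
    (c : S') :
    landauCf L (1 : B7Prop1Explicit.Site d → Fin d → 𝔸ˣ) k S S' A c
      = logIter L (scaleIns L k S A) k c.1.1 c.1.2 - linQIter L (scaleIns L k S A) k c.1.1 c.1.2 := by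
  have hb : 0 ≤ ((L : ℝ) ^ k)⁻¹ * ‖A‖ := by positivity
  simp only [landauCf, logCovIter_one_left, linCovIter_one_left hL (scaleIns L k S A) hb (norm_scaleIns_le L k S A)]

/-! ## §4 (44)'s scaling display -/

section Scaling

variable (L : ℕ) (hL : 2 ≤ L) {G : Subgroup 𝔸ˣ} (hG : AvgClosed d L G) (k : ℕ)
  (U₀ : B7Prop1Explicit.Site d → Fin d → 𝔸ˣ) (hU₀ : ∀ x κ, U₀ x κ ∈ G) {α₀ : ℝ} (hα : 0 < α₀)
  (hα3 : C0 d * α₀ ≤ 1 / 3) (hα4 : 4 * α₀ ≤ c2' d L) (hα6 : 4 * O1cov d * α₀ ≤ 1 / 3)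
  (h52 : pdev U₀ < α₀ * (((L : ℝ) ^ k)⁻¹) ^ 2) (S S' : Finset (B7Prop1Explicit.Site d × Fin d))

include hL hG hU₀ hα hα3 hα4 hα6 h52 in
/-- **(44)'s DISPLAY «|C_j(LʲηA)| ≦ C₂(Lʲη)²|A|²»** — the square of the scaling factor: under S64's binders, for a scalar `t` with
`‖t • A‖ < landauRad(d,L)`, `‖landauCf (t • A)‖ ≤ C2cov(d)·‖t‖²·‖A‖²` (`t` playing `Lʲη`; the identification of `A` with B11's
sectioned field on `Ω_j` is W-c [dict] + geometry — said, not claimed). [cite: Balaban1985Variational, (44) p.285] -/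
theorem norm_landauCf_smul_le (t : ℂ) (A : S → 𝔸) (htA : ‖t • A‖ < landauRad d L) :
    ‖landauCf L U₀ k S S' (t • A)‖ ≤ C2cov d * ‖t‖ ^ 2 * ‖A‖ ^ 2 := by
  have h := (landauCorrection_binders L hL hG k U₀ hU₀ hα hα3 hα4 hα6 h52 S S').1 (t • A) htA
  rw [norm_smul, mul_pow, ← mul_assoc] at h
  exact h

end Scaling

end Summit.QuantumFields.BalabanUV.T4Continuum.ShellMeasureLandauCorrectionB7Flat

end
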